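import Mathlib
import HarnessLib
import HarnessLib.Audit
import Summits.Schanuel.Statement

/-!
Route: MatrixCoefficients

DORMANT since 2026-09-04T19:07:00Z (reconciler: no traction for 5 d (last activity statement-checked at 2026-08-30T18:10:50Z); parked, not closed — `ledger route dormant route-Schanuel-MatrixCoefficients --off` to reactivate) — unstaffed, not closed; items shared with open routes are served there. `ledger route dormant <id> --off` reactivates.

# Route MatrixCoefficients — singular log-matrices have a rational isotropic pair; pay auxiliary
polynomials by support, not degree

It suffices to show X = LogSector ∧ OffLogSector, the exact split of Schanuel at 𝓛 = exp⁻¹(ℚ̄) (both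
decls and the Assembly are SHARED
verbatim with route LogPatterns; X ⟺ Schanuel). This route is the ALTERNATIVE decomposition of
LogSector harvested from a printed open
programme, Dasgupta–Kakde's MATRIX COEFFICIENT CONJECTURE (DasguptaKakde2024 = arXiv:2408.08178
Conj. 1.2; Dasgupta2023 §6): a singular
square matrix M with entries in 𝓛 has nonzero rational w, v with wᵗMv = 0 — one rational zero after
a rational change of bases on both
sides, instead of Roy's structural-rank equality. The ranked rungs, all consequences of LogSector
(supports ZeroBlockOfLogSector,
MatrixCoefficientOfLogSector), are: the first open cell MatrixCoefficientThree (3×3, open exactly at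
rank 2; n = 2 IS the four exponentials
conjecture, support MatrixCoefficientTwoIffFourExp), the full conjecture MatrixCoefficient, its
AUXILIARY-POLYNOMIAL NORMAL FORM
SparseVanishing (= the authors' open implication "(w) ⟹ (m′)": singularity of (log x_ij) forces, for
all large N, a nonzero polynomial with
fewer than Nⁿ monomials vanishing on the box-image X(2N) of the row group), and the log-free
converse SupportMasser ("(m′) ⟹ (o)": a
support-counting Masser theorem). No Target block: X is the conjunction of the two shared cruxes.
Lean: `(∀ (n : ℕ) (l : Fin n → ℂ), (∀ i, IsAlgebraic ℚ (Complex.exp (l i))) → LinearIndependent ℚ l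
→ AlgebraicIndependent ℚ l) ∧ (∀ (n : ℕ) (x : Fin n → ℂ), LinearIndependent ℚ ((Submodule.span ℚ {z
: ℂ | IsAlgebraic ℚ (Complex.exp z)}).mkQ ∘ x) → (n : Cardinal) ≤ Algebra.trdeg
↥(IntermediateField.adjoin ℚ {z : ℂ | IsAlgebraic ℚ (Complex.exp z)}) ↥(IntermediateField.adjoin
↥(IntermediateField.adjoin ℚ {z : ℂ | IsAlgebraic ℚ (Complex.exp z)}) (Set.range x ∪ Set.range
(Complex.exp ∘ x))))`

## Assembly
Elementary but real Lean work, SHARED with route LogPatterns (same decl, same signature; the same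
split over ecl ∅ is
`Literature.NumberTheory.Transcendental.schanuelConjecture_iff_ecl_empty_of_kirby`): given z ∈ ℂⁿ
ℚ-linearly independent, choose
P ∈ GL_n(ℚ) with Pz = (z″, z′), z″ a basis of span_ℚ z ∩ 𝓛; LogSector makes z″ algebraically
independent with e^{z″} algebraic, OffLogSector
adds trdeg ≥ n − k over ℚ(𝓛) ⊇ ℚ(z″), and the tower law sums to n. The deciding theorem `closes`
takes the two sector cruxes and this
Assembly item (plus the four rungs, which are items, not logical inputs — this is a ladder inside
LogSector) and concludes `Schanuel`.

Rationale: WHY THIS LINE. Mechanism (operator open-question-harvest; DasguptaKakde2024 §5–§7, printed open: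
"(w) ⟹ (m) … we do not know how to prove this statement",
"to prove the 4 exponentials conjecture over ℝ or ℂ_p it suffices to prove (w) ⟹ (m′) … this
implication remains a mystery", Question 7.4):
change BOTH ends of the Waldschmidt–Masser theorem (Waldschmidt1981 (W) ⟹ (M); Masser1981 (M) ⟹ (O);
Roy1995 r ≥ s/2) — the conclusion from a
zero BLOCK of size m′+n′ > n to a single rational matrix coefficient (the weakest rational shadow of
singularity; DK Thm 2.2: every singular
space of matrices has a common isotropic pair), and the CURRENCY of the auxiliary polynomial from
its degree to its SUPPORT / Newton-polytope
volume (Bernstein–Kushnirenko degree), so that Masser's geometric half still converts under the weak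
hypothesis corank ≥ 1 (DK Thm 6.1
(m) ⟹ (o), proved; Prop 5.6 (o) ⟹ (m); n = 2 over ℝ: (m′) ⟹ (o) by Descartes' rule for real
exponential sums, DK Thm 7.1). Imported area:
toric / fewnomial algebraic geometry (BKK mixed volumes, support-counted interpolation; cf.
Philippon–Sombra doi:10.1016/j.aim.2008.03.019
for sparse arithmetic Bézout) pointed at linear forms in logarithms; the p-adic instances imply
Leopoldt and Gross–Kuz'min (DK Thms 3.1–3.2),
which is the authors' motivation. What it does that the 21 open routes do not: no route uses
auxiliary-polynomial SUPPORT as the counting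
currency or the bilinear matrix-coefficient target — LogPatterns stakes value PATTERNS (T(G₂)),
GeodesicRealLogs quadratic-form cells (GP₃/PDQ),
DilateIntersection forbidden configurations, AdelicLogSector Fermat quotients, CapacityLadder the
DEGREE-capacity n/2 bookkeeping that this
currency is designed to leave, RoyCriterion small values in ordinary bidegrees, ToricSector the
toric geometry of RELATION ideals (not of
auxiliary polynomials). Planner deltas beyond the source: (i) the ZERO-BLOCK LADDER "numerical rank
r ⇒ rational (n−r)×(n−r) zero block"
(support ZeroBlockOfLogSector: LogSector ⇒ it by the max-rank-element argument; proved
unconditionally only with n−2r in place of n−r, which is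
Roy1995 Cor 1.3 / tree fact roy1995_structuralRank_le_two_mul_rank — the factor-2 barrier in block
form; MatrixCoefficient is its r = n−1 end);
(ii) the support-count normal form for all n with its log-free converse as a separately decidable
crux; (iii) a numerology census for the
rank-4 crux (NOTES.md): interpolation determinants on thin supports aligned with Dirichlet
approximants of ker M buy analytic growth but not
height — smallness m·N^{n/(n−1)} against height m·Nⁿ ties at n = 2 (four exponentials) and loses for
n ≥ 3, so the printed "mystery" is real.

RANKED CRUXES. #2 MatrixCoefficientThree (crux) — Dasgupta–Kakde's Matrix Coefficient Conjecture at
n = 3, its first open cell (rank ≤ 1 falls to Waldschmidt–Masser, so the content is rank exactly 2):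
a 3×3 matrix of logarithms of algebraic numbers with vanishing determinant has nonzero rational w, v
with wᵗMv = 0. [difficulty: open-problem] (why it might fail: a cubic analogue of four exponentials
on the determinantal cubic in 𝓛⁹, where the linear subgroup theorem gives only r ≥ s/2 (vacuous at
rank 2) and no method reaches corank 1; false only if AlgIndepLogs (hence Schanuel) fails.)
[DasguptaKakde2024, Dasgupta2023, Roy1995, Waldschmidt1981, Masser1981]
#3 SupportMasser (crux) — support-counting Masser converse "(m′) ⟹ (o)", log-free and over ℂ: if for
nonzero x_ij (i, j ≤ n) and infinitely many N some nonzero polynomial with fewer than Nⁿ monomials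
vanishes on the box-image X(2N) = {(∏ᵢ x_ij^{vᵢ})ⱼ : v ∈ [0,2N)ⁿ}, then the multiplicative pairing
⟨a, b⟩_X = ∏ x_ij^{aᵢbⱼ} has a rational isotropic pair (⟨a, b⟩_X = 1, a, b ≠ 0). Proved for dense
currency (deg P < N: Masser1981 Thm 2) and, under rank 1, for n = 2 over ℝ (DK Thm 7.1); n = 1 is
the order-s recurrence with s consecutive zeros. [difficulty: L] (why it might fail: ¬(o) forbids
only exact isotropic pairs; for n ≥ 2 a sparse support spread over > 4N exponents can sit in the
kernel of the box-evaluation matrix without orthogonality (DK need BK-degree, not support count, for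
n ≥ 3); one explicit configuration refutes it.) [Masser1981, DasguptaKakde2024,
doi:10.1016/j.aim.2008.03.019]
#4 SparseVanishing (crux) — the auxiliary-polynomial normal form "(w) ⟹ (m′)" of the Matrix
Coefficient Conjecture, all n: if L is an n×n matrix of logarithms of algebraic numbers x_ij =
e^{L_ij} with det L = 0, then for every large N there is a nonzero complex polynomial in n variables
with fewer than Nⁿ monomials vanishing on X(2N) = {(∏ᵢ x_ij^{vᵢ})ⱼ : v ∈ [0,2N)ⁿ}. Implied by
MatrixCoefficient (support SparseOfIsotropic: the witness is supported on a segment, O(N^{n−1})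
terms); this is the statement a transcendence construction must deliver, and the authors' printed
open implication. [deps: SupportMasser] [difficulty: open-problem] (why it might fail: as a
statement it is false only with four exponentials / AlgIndepLogs; as a LINE, Siegel's lemma fills
boxes (support ~ degⁿ) and thin supports buy analytic growth but not height: interpolation
determinants tie at n = 2 and lose N^{n−n/(n−1)} for n ≥ 3.) [DasguptaKakde2024, Waldschmidt1981,
Laurent1991, Roy1995]
#5 MatrixCoefficient (crux) — the Matrix Coefficient Conjecture (DasguptaKakde2024 Conj. 1.2), all
n: an n×n matrix with entries in 𝓛 = {z : e^z ∈ ℚ̄} and vanishing determinant has nonzero rational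
w, v with wᵗMv = 0. Strictly weaker in form than the Structural Rank Conjecture (DK Thm 2.1),
equivalent to four exponentials at n = 2, and the r = n−1 end of the zero-block ladder. [deps:
MatrixCoefficientThree] [difficulty: open-problem] (why it might fail: contains four exponentials (n
= 2) and every corank-1 cell beyond Roy's r ≥ s/2; no transcendence method is known to exploit
corank 1; false only with AlgIndepLogs.) [DasguptaKakde2024, Dasgupta2023, Roy1995, Waldschmidt2005]
#6 LogSector (crux) — algebraic independence of ℚ-linearly independent logarithms of algebraic
numbers (Schanuel restricted to 𝓛; shared verbatim with route LogPatterns; Roy: ⟺ Structural Rank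
Conjecture). [deps: MatrixCoefficient] [difficulty: open-problem] (why it might fail: open for every
n ≥ 2 — no two logarithms of algebraic numbers are known algebraically independent (Roy1992 p.22);
Baker gives degree 1, the linear subgroup theorem only r ≥ s/2 (Roy1995).) [Roy1992, Roy1995,
Waldschmidt2000, BakerTNT1975]
#7 OffLogSector (crux) — Schanuel relative to K₀ = ℚ(𝓛): for x₁…xₙ ℚ-linearly independent modulo the
ℚ-span of 𝓛, trdeg_{K₀} K₀(x, eˣ) ≥ n (shared verbatim with route LogPatterns; the exact complement
of the sector). [difficulty: open-problem] (why it might fail: it is most of Schanuel (n = 1 already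
contains e ∉ ℚ(𝓛)‾ and π ⊥ log 2); no transcendence method works relative to the infinitely
generated base ℚ(𝓛); this route adds nothing to it.) [Kirby2010EAEF, Waldschmidt2000]
#9 ZeroBlockOfLogSector (support) — the zero-block ladder from the sector (planner-derived; DK Thm
2.2 generalised): under LogSector, an n×n matrix over 𝓛 of rank ≤ r admits a rational (n−r)×(n−r)
zero block — lin. independent rational W₁…W_{n−r}, V₁…V_{n−r} with WₖᵗMV_l = 0. Proof: ℚ-basis λ of
the entries inside 𝓛, M = Σ λₜAₜ; the (r+1)-minors of Σ XₜAₜ vanish at the algebraically independent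
λ hence identically; pick a rational element of maximal rank ρ ≤ r in the span, bring it to
diag(1_ρ, 0) by GL_n(ℚ)²; the t^ρ-coefficient of the (ρ+1)-minors of tA + B kills the complementary
block of every B in the span. ~400 lines over Mathlib. [difficulty: provable-now]
[DasguptaKakde2024, Dasgupta2023, Roy1995]
#9 MatrixCoefficientOfLogSector (support) — calibration LogSector ⟹ MatrixCoefficient (det M = 0 ⟹
rank ≤ n−1 ⟹ the r = n−1 case of ZeroBlockOfLogSector gives a 1×1 rational zero block); DK Thm 2.1
through Roy's/Dasgupta's easy direction AlgIndepLogs ⟹ SRC. [difficulty: provable-now]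
[DasguptaKakde2024, Dasgupta2023]
#9 MatrixCoefficientTwoIffFourExp (support) — at n = 2 the Matrix Coefficient Conjecture is exactly
the four exponentials conjecture (DK §1, "easy to show"): a singular 2×2 matrix over 𝓛 is 0 or x·yᵗ
with all e^{xᵢyⱼ} algebraic, and wᵗ(xyᵗ)v = (w·x)(v·y). Pure algebra, ~150 lines. [difficulty:
provable-now] [DasguptaKakde2024, Waldschmidt2005]
#9 SparseOfIsotropic (support) — the easy converse (o) ⟹ (m′) (DasguptaKakde2024 Prop 5.6 for the
box X(2N)): an isotropic pair ⟨a, b⟩_X = 1 makes v ↦ ⟨v, b⟩_X periodic modulo ℤa, so it takes ≤ C_a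
N^{n−1} values u_k on [0,2N)ⁿ, and P = ∏ₖ (t^{b⁺} − u_k t^{b⁻}) (b = b⁺ − b⁻) is nonzero, supported
on a segment (≤ C_a N^{n−1} + 1 monomials < Nⁿ for large N) and vanishes on X(2N). Calibrates
SparseVanishing and SupportMasser as mutual converses. ~300 lines. [difficulty: provable-now]
[DasguptaKakde2024, Masser1981]
#9 ChainToMultiplicative (support) — what the authors' chain reaches over ℂ (planner's correction:
the box-image X sees x_ij = e^{L_ij} only, so (w) ⟹ (m′) ⟹ (o) yields the MULTIPLICATIVE matrix
coefficient aᵗLb ∈ 2πiℤ, which is wᵗLv = 0 exactly when L is real or 2πi-free — DK Thm 7.1 is stated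
over ℝ and ℂ_p for this reason): SparseVanishing and SupportMasser give, for every singular L over
𝓛, nonzero integer a, b and k ∈ ℤ with Σ aᵢbⱼL_ij = 2πik. Composition + Complex.exp_eq_one_iff, ~80
lines. [difficulty: provable-now] [DasguptaKakde2024]

TWO-LAYER PLAN. Foreseen glued splits once a rung closes: the multiplicative matrix coefficient
(support ChainToMultiplicative's conclusion, = MatrixCoefficient
for real / 2πi-free L) ⇐ SparseVanishing → SupportMasser (the authors' (w) ⟹ (m′) ⟹ (o) chain, k =
2); MatrixCoefficientThree ⇐ (rank-2 real entries) → (rank-2 general) if a fewnomial argument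
appears for 3×3 over ℝ; SupportMasser ⇐
(n = 2) → (n ≥ 3 with BK-degree in place of support count, DK Thm 6.1) if the support-count form is
refuted for n ≥ 3.

KILL CRITERIA. An explicit configuration refuting SupportMasser (class misstated): repair by
restating with the Bernstein–Kushnirenko degree BKd(P) < Nⁿ and the
box X(nN), for which (m) ⟹ (o) is DK Thm 6.1 (proved) — pre-registered repair, not a close. A
refutation of MatrixCoefficientThree or
MatrixCoefficient is a counterexample to AlgIndepLogs, hence to Schanuel: close `refuted:` and the
summit is decided negatively. SparseVanishing
refuted ⇒ (by SparseOfIsotropic) MatrixCoefficient refuted, same. If LogPatterns' Assembly or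
LogSector is proved elsewhere the shared items close
here too; if a prover lands MatrixCoefficient from LogSector only (the support), nothing is learned
— the rungs are targets for UNCONDITIONAL proofs.

NOT DECOMPOSED YET. The BK-degree form (m) of the normal form (mixed volumes are not in Mathlib;
filed informally if SupportMasser dies); the p-adic instances
(Leopoldt, Gross–Kuz'min: off-statement); the real 2×2 fewnomial cell (it is four exponentials over
ℝ verbatim, GeodesicRealLogs territory);
the known rung "rank r < n/2 ⇒ (n−2r)×(n−2r) rational zero block" from the tree fact
roy1995_structuralRank_le_two_mul_rank (a Literature
import this Mathlib-only file avoids); any transcendence construction for SparseVanishing (layer-2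
children: support-constrained Siegel lemma,
thin-cylinder interpolation determinants, Baker-pruned supports).

CHEAPEST FALSIFIER. SupportMasser's finite shadow by computation: for random integer 2×2 and 3×3
matrices x with no isotropic pair and N = 5…8, decide by exact
linear algebra over ℚ whether some support S ⊂ [0, D]ⁿ with |S| < Nⁿ (D up to ~N²) carries a nonzero
P vanishing on X(2N) — the kernel of
the box-evaluation matrix (x^{⟨v,w⟩})_{v,w}; for 2×2 with injective characters and N ≤ 4 the
planner's Krylov argument (NOTES.md) already
excludes it, so start at N = 5. Not run this cycle (no kit job from a draft route); a refuter's
first move. Second: the Lean proof of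
MatrixCoefficientTwoIffFourExp (pure algebra) certifies the n = 2 calibration.

NUMBERS. Zero-block ladder for an n×n matrix over 𝓛 of rank r: predicted block (n−r)×(n−r)
(LogSector ⇒, support); proved (n−2r)×(n−2r) for 2r < n
(Roy1995 Cor 1.3, s ≤ 2r; Waldschmidt–Masser m′/m + n′/n > 1 from rank < mn/(m+n));
MatrixCoefficient = block ≥ 1×1 at r = n−1, open for all
n ≥ 2; n = 2 ⟺ four exponentials; n = 3 open exactly at rank 2. Auxiliary currency: Masser needs deg
P < N on X(nN) (support ~ Nⁿ/n! in a
simplex); DK's (m) asks BKd(P) < Nⁿ, (m′) asks |S(P)| < Nⁿ on X(2N); the isotropic witness has ≤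
C·N^{n−1} + 1 monomials on a segment.
Items at open: 12 (1 assembly, 6 cruxes of which 2 shared, 5 supports).

DEFINITION REQUESTS. None: everything is stated over Mathlib (Matrix.det, Matrix.rank,
MvPolynomial.support, MvPolynomial.eval, IsAlgebraic, Complex.exp);
𝓛-membership is inlined as `IsAlgebraic ℚ (Complex.exp z)`; the route file imports no Literature
module.

Novelty: Searches (2026-08-16): `lit frontier Schanuel --since 2021` (60 rows; Pila 2026, Binyamini et al.
2026, Bertolin/Waldschmidt 2025–26 read);
`lit search "Schanuel conjecture" --source zbmath --year-from 2021` (50 rows: Dasgupta2023 found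
here) and `--source arxiv` (14);
`lit search "ti:Schanuel" --source zbmath --year-from 2019` (29); `lit search "matrix coefficient
conjecture logarithms" --source arxiv`
(1: arXiv:2408.08178); novelty probes `lit search "Newton polytope zero estimate"` arxiv+zbmath
(Binyamini 2016 multiplicity estimates,
Philippon–Sombra 2008 sparse BKK — no use on logarithms), `"fewnomial transcendence"`, `"sparse
auxiliary polynomial"`, `"Turan Nazarov
exponential sums zeros"` (0 relevant); `lit search --hybrid "Masser polynomials exponential
polynomials several variables …"` (local: Baker
1975, LNM1752, Chudnovsky 1984 — dense currency only); `lit galaxy search "conjectures of Schanuel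
and Zilber" --star all` (0);
`lit galaxy topic "Schanuel's conjecture … open problems" --star pdf` (60, noise); `ledger negatives
--problem Schanuel` (2, PolarPhantoms, unrelated).
Nearest prior art found: DasguptaKakde2024 (arXiv:2408.08178, Adv. Math.) — the conjecture, Thm 2.1
(SRC ⇒ MCC), the (w) ⇒ (m) ⇒ (o)
strategy with Thm 6.1 and Thm 7.1, and the printed open implications; Dasgupta2023
(arXiv:2303.02037) §6; Masser1981 / Waldschmidt1981 /
Roy1995 (dense currency and its r ≥ s/2 ceiling).
Delta: files the authors' printed open implication as a summit-deciding ladder in  [refs: 2408.08178, 2303.02037, Dasgupta2023, DasguptaKakde2024, Masser1981, Waldschmidt1981, Roy1995]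

Barriers (technique_class: matrix-coefficients, sparse-auxiliary-polynomial, LST): - technique_class: matrix-coefficients, sparse-auxiliary-polynomial, LST
- Literature.Barriers.Schanuel.AlgebraicIndependenceOfLogarithms: it does not evade the STRENGTH
barrier — every rung lies inside LogSector beyond r ≥ s/2; the bet is that the corank-1 /
one-coefficient end is reachable by a support-counted auxiliary polynomial where rank-counting
provably stops at half (the ladder's proved rung is exactly the tree fact
roy1995_structuralRank_le_two_mul_rank).
- Literature.Barriers.Schanuel.LinearSubgroupMethodLimit: Roy's no-go kills linear embeddings into
determinantal varieties + LST: n = 2 (four exponentials) is on its list and the 3×3 determinantal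
cubic gets only r ≥ s/2; the line does not embed — its geometric half is Masser's ideal-theoretic
argument with BKK counts (DK Thm 6.1), outside the theorem's hypotheses; conceded: no transcendence
half exists yet, so the evasion is formal, not demonstrated.
- Literature.Barriers.Schanuel.LargeTranscendenceDegree: not met (no transcendence-degree ≥ 2
statements; the rungs are rational-structure statements about singular log-matrices).
- Literature.Barriers.Schanuel.PeriodConjectureOverQbarScope: consistent — the whole route lives in
the sector the period conjectures over ℚ̄ reach (AlgIndepLogs); it claims nothing off the sector
beyond the shared OffLogSector.
- Literature.Barriers.Schanuel.AxSchanuelFunctionalNotNumerical / AxiomsDoNotForceSchanuel /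
SchanuelPropertyNotFirstOrder: not in the technique class (no functional

History (route lifecycle, newest last):
- 2026-08-23T10:39:52Z · DORMANT — reconciler: no traction for 6.1 d (last activity item-evidence-added at 2026-08-17T08:23:59Z); parked, not closed — `ledger route dormant route-Schanuel-MatrixC (operator:999:1541262)
- 2026-08-30T04:23:14Z · REACTIVATED — reconciler: reactivated — activity statement-attached at 2026-08-30T03:19:58Z after parking at 2026-08-23T10:39:52Z (operator:999:1986478)
- 2026-09-04T19:07:00Z · DORMANT — reconciler: no traction for 5 d (last activity statement-checked at 2026-08-30T18:10:50Z); parked, not closed — `ledger route dormant route-Schanuel-MatrixCoeff (operator:999:2451566)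

sub-problem: Schanuel · status: dormant · opened planner-plan-novel-Schanuel-Schanuel-03fec9a6-a-g2-0 2026-08-16T15:02:20Z · rev 3 · ledger route-Schanuel-MatrixCoefficients
GENERATED by the gate from the ledger (D-0016/17). Provers cite these decls: `theorem foo : Summit.Schanuel.Schanuel.Theses.MatrixCoefficients.<Decl> := …` in Summits/Schanuel/Schanuel/Theorems/<Name>.lean.
-/

namespace Summit.Schanuel.Schanuel.Theses.MatrixCoefficients

open scoped BigOperators Topology Manifold Classical MeasureTheory ProbabilityTheory Matrix InnerProductSpace ComplexConjugate ContinuousMap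
open Filter Set Function TopologicalSpace MeasureTheory

attribute [summit_statement] _root_.Schanuel

open Literature.Periods

/-- item stmt-Schanuel-15346 · crux · rank 2 · open · by planner
why it might fail: a cubic analogue of four exponentials on the determinantal cubic in 𝓛⁹, where the linear subgroup theorem gives only r ≥ s/2 (vacuous at rank 2) and no method reaches corank 1; false only if AlgIndepLogs (hence Schanuel) fails.
sources: DasguptaKakde2024, Dasgupta2023, Roy1995, Waldschmidt1981, Masser1981
[crux] Dasgupta–Kakde's Matrix Coefficient Conjecture at n = 3, its first open cell (rank ≤ 1 falls
to Waldschmidt–Masser, so the content is rank exactly 2): a 3×3 matrix of logarithms of algebraic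
numbers with vanishing determinant has nonzero rational w, v with wᵗMv = 0. [difficulty:
open-problem] -/
@[route_item "route-Schanuel-MatrixCoefficients"]
def MatrixCoefficientThree : Prop :=
  ∀ M : Matrix (Fin 3) (Fin 3) ℂ, (∀ i j, IsAlgebraic ℚ (Complex.exp (M i j))) → M.det = 0 → ∃ w v : Fin 3 → ℚ, w ≠ 0 ∧ v ≠ 0 ∧ ∑ i, ∑ j, (w i : ℂ) * M i j * (v j : ℂ) = 0

/-- item stmt-Schanuel-15347 · crux · rank 3 · open · by planner
why it might fail: ¬(o) forbids only exact isotropic pairs; for n ≥ 2 a sparse support spread over > 4N exponents can sit in the kernel of the box-evaluation matrix without orthogonality (DK need BK-degree, not support count, for n ≥ 3); one explicit configuration refutes it.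
sources: Masser1981, DasguptaKakde2024, doi:10.1016/j.aim.2008.03.019
[crux] support-counting Masser converse "(m′) ⟹ (o)", log-free and over ℂ: if for nonzero x_ij (i, j
≤ n) and infinitely many N some nonzero polynomial with fewer than Nⁿ monomials vanishes on the
box-image X(2N) = {(∏ᵢ x_ij^{vᵢ})ⱼ : v ∈ [0,2N)ⁿ}, then the multiplicative pairing ⟨a, b⟩_X = ∏
x_ij^{aᵢbⱼ} has a rational isotropic pair (⟨a, b⟩_X = 1, a, b ≠ 0). Proved for dense currency (deg P
< N: Masser1981 Thm 2) and, under rank 1, for n = 2 over ℝ (DK Thm 7.1); n = 1 is the order-s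
recurrence with s consecutive zeros. [difficulty: L] -/
@[route_item "route-Schanuel-MatrixCoefficients"]
def SupportMasser : Prop :=
  ∀ (n : ℕ) (x : Fin n → Fin n → ℂ), (∀ i j, x i j ≠ 0) → (∀ N₀ : ℕ, ∃ N : ℕ, N₀ ≤ N ∧ ∃ P : MvPolynomial (Fin n) ℂ, P ≠ 0 ∧ P.support.card < N ^ n ∧ ∀ v : Fin n → ℕ, (∀ i, v i < 2 * N) → MvPolynomial.eval (fun j => ∏ i, x i j ^ (v i)) P = 0) → ∃ a b : Fin n → ℤ, a ≠ 0 ∧ b ≠ 0 ∧ ∏ i, ∏ j, x i j ^ (a i * b j) = 1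

/-- item stmt-Schanuel-15348 · crux · rank 4 · open · by planner
why it might fail: as a statement it is false only with four exponentials / AlgIndepLogs; as a LINE, Siegel's lemma fills boxes (support ~ degⁿ) and thin supports buy analytic growth but not height: interpolation determinants tie at n = 2 and lose N^{n−n/(n−1)} for n ≥ 3.
sources: DasguptaKakde2024, Waldschmidt1981, Laurent1991, Roy1995
[crux] the auxiliary-polynomial normal form "(w) ⟹ (m′)" of the Matrix Coefficient Conjecture, all
n: if L is an n×n matrix of logarithms of algebraic numbers x_ij = e^{L_ij} with det L = 0, then for
every large N there is a nonzero complex polynomial in n variables with fewer than Nⁿ monomials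
vanishing on X(2N) = {(∏ᵢ x_ij^{vᵢ})ⱼ : v ∈ [0,2N)ⁿ}. Implied by MatrixCoefficient (support
SparseOfIsotropic: the witness is supported on a segment, O(N^{n−1}) terms); this is the statement a
transcendence construction must deliver, and the authors' printed open implication. [deps:
SupportMasser] [difficulty: open-problem] -/
@[route_item "route-Schanuel-MatrixCoefficients"]
def SparseVanishing : Prop :=
  ∀ (n : ℕ) (L : Matrix (Fin n) (Fin n) ℂ), (∀ i j, IsAlgebraic ℚ (Complex.exp (L i j))) → L.det = 0 → ∃ N₀ : ℕ, ∀ N : ℕ, N₀ ≤ N → ∃ P : MvPolynomial (Fin n) ℂ, P ≠ 0 ∧ P.support.card < N ^ n ∧ ∀ v : Fin n → ℕ, (∀ i, v i < 2 * N) → MvPolynomial.eval (fun j => ∏ i, Complex.exp (L i j) ^ (v i)) P = 0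

/-- item stmt-Schanuel-15349 · crux · rank 5 · open · by planner
why it might fail: contains four exponentials (n = 2) and every corank-1 cell beyond Roy's r ≥ s/2; no transcendence method is known to exploit corank 1; false only with AlgIndepLogs.
sources: DasguptaKakde2024, Dasgupta2023, Roy1995, Waldschmidt2005
[crux] the Matrix Coefficient Conjecture (DasguptaKakde2024 Conj. 1.2), all n: an n×n matrix with
entries in 𝓛 = {z : e^z ∈ ℚ̄} and vanishing determinant has nonzero rational w, v with wᵗMv = 0.
Strictly weaker in form than the Structural Rank Conjecture (DK Thm 2.1), equivalent to four
exponentials at n = 2, and the r = n−1 end of the zero-block ladder. [deps: MatrixCoefficientThree]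
[difficulty: open-problem] -/
@[route_item "route-Schanuel-MatrixCoefficients"]
def MatrixCoefficient : Prop :=
  ∀ (n : ℕ) (M : Matrix (Fin n) (Fin n) ℂ), (∀ i j, IsAlgebraic ℚ (Complex.exp (M i j))) → M.det = 0 → ∃ w v : Fin n → ℚ, w ≠ 0 ∧ v ≠ 0 ∧ ∑ i, ∑ j, (w i : ℂ) * M i j * (v j : ℂ) = 0

/-- item stmt-Schanuel-4310 · crux · rank 6 · open · by planner
why it might fail: open for every n ≥ 2 — no two logarithms of algebraic numbers are known algebraically independent (Roy1992 p.22); Baker gives degree 1, the linear subgroup theorem only r ≥ s/2 (Roy1995).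
sources: Roy1992, Roy1995, Waldschmidt2000, BakerTNT1975
[crux] algebraic independence of logarithms (card's standing hypothesis AlgIndepLogs; verbatim the
signature of stmt-Schanuel-0083 and of `Literature.Barriers.Schanuel.AlgIndepLogarithms`):
ℚ-linearly independent l₁…lₙ with e^{lᵢ} algebraic are algebraically independent. The sector the
pattern model lives in; Schanuel restricted to 𝓛ⁿ. [difficulty: open-problem] -/
@[route_item "route-Schanuel-MatrixCoefficients"]
def LogSector : Prop :=
  ∀ (n : ℕ) (l : Fin n → ℂ), (∀ i, IsAlgebraic ℚ (Complex.exp (l i))) → LinearIndependent ℚ l → AlgebraicIndependent ℚ l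

/-- item stmt-Schanuel-4311 · crux · rank 7 · open · by planner
why it might fail: it is most of Schanuel (n = 1 already contains e ∉ ℚ(𝓛)‾ and π ⊥ log 2); no transcendence method works relative to the infinitely generated base ℚ(𝓛); this route adds nothing to it.
sources: Kirby2010EAEF, Waldschmidt2000
[crux] Schanuel relative to K₀ = ℚ(𝓛), 𝓛 = {z : e^z ∈ ℚ̄}: if x₁…xₙ ∈ ℂ are ℚ-linearly independent
modulo the ℚ-span of 𝓛, then trdeg over K₀ of K₀(x, eˣ) is ≥ n. The complement of the log sector
(contains e transcendental over ℚ(𝓛), hence e ⊥ π); Schanuel ⇒ it (support OffLogSectorOfSchanuel)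
and LogSector ∧ OffLogSector ⇒ Schanuel (Assembly). [difficulty: open-problem] -/
@[route_item "route-Schanuel-MatrixCoefficients"]
def OffLogSector : Prop :=
  ∀ (n : ℕ) (x : Fin n → ℂ), LinearIndependent ℚ ((Submodule.span ℚ {z : ℂ | IsAlgebraic ℚ (Complex.exp z)}).mkQ ∘ x) → (n : Cardinal) ≤ Algebra.trdeg ↥(IntermediateField.adjoin ℚ {z : ℂ | IsAlgebraic ℚ (Complex.exp z)}) ↥(IntermediateField.adjoin ↥(IntermediateField.adjoin ℚ {z : ℂ | IsAlgebraic ℚ (Complex.exp z)}) (Set.range x ∪ Set.range (Complex.exp ∘ x)))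

/-- item stmt-Schanuel-15350 · support · rank 9 · open · by planner
sources: DasguptaKakde2024, Dasgupta2023, Roy1995
[support] the zero-block ladder from the sector (planner-derived; DK Thm 2.2 generalised): under
LogSector, an n×n matrix over 𝓛 of rank ≤ r admits a rational (n−r)×(n−r) zero block — lin.
independent rational W₁…W_{n−r}, V₁…V_{n−r} with WₖᵗMV_l = 0. Proof: ℚ-basis λ of the entries inside
𝓛, M = Σ λₜAₜ; the (r+1)-minors of Σ XₜAₜ vanish at the algebraically independent λ hence
identically; pick a rational element of maximal rank ρ ≤ r in the span, bring it to diag(1_ρ, 0) by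
GL_n(ℚ)²; the t^ρ-coefficient of the (ρ+1)-minors of tA + B kills the complementary block of every B
in the span. ~400 lines over Mathlib. [difficulty: provable-now] -/
@[route_item "route-Schanuel-MatrixCoefficients"]
def ZeroBlockOfLogSector : Prop :=
  (∀ (n : ℕ) (l : Fin n → ℂ), (∀ i, IsAlgebraic ℚ (Complex.exp (l i))) → LinearIndependent ℚ l → AlgebraicIndependent ℚ l) → ∀ (n r : ℕ) (M : Matrix (Fin n) (Fin n) ℂ), (∀ i j, IsAlgebraic ℚ (Complex.exp (M i j))) → M.rank ≤ r → ∃ W V : Fin (n - r) → (Fin n → ℚ), LinearIndependent ℚ W ∧ LinearIndependent ℚ V ∧ ∀ k l, ∑ i, ∑ j, (W k i : ℂ) * M i j * (V l j : ℂ) = 0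

/-- item stmt-Schanuel-15351 · support · rank 9 · open · by planner
sources: DasguptaKakde2024, Dasgupta2023
[support] calibration LogSector ⟹ MatrixCoefficient (det M = 0 ⟹ rank ≤ n−1 ⟹ the r = n−1 case of
ZeroBlockOfLogSector gives a 1×1 rational zero block); DK Thm 2.1 through Roy's/Dasgupta's easy
direction AlgIndepLogs ⟹ SRC. [difficulty: provable-now] -/
@[route_item "route-Schanuel-MatrixCoefficients"]
def MatrixCoefficientOfLogSector : Prop :=
  LogSector → MatrixCoefficient

/-- item stmt-Schanuel-15352 · support · rank 9 · open · by planner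
sources: DasguptaKakde2024, Waldschmidt2005
[support] at n = 2 the Matrix Coefficient Conjecture is exactly the four exponentials conjecture (DK
§1, "easy to show"): a singular 2×2 matrix over 𝓛 is 0 or x·yᵗ with all e^{xᵢyⱼ} algebraic, and
wᵗ(xyᵗ)v = (w·x)(v·y). Pure algebra, ~150 lines. [difficulty: provable-now] -/
@[route_item "route-Schanuel-MatrixCoefficients"]
def MatrixCoefficientTwoIffFourExp : Prop :=
  (∀ M : Matrix (Fin 2) (Fin 2) ℂ, (∀ i j, IsAlgebraic ℚ (Complex.exp (M i j))) → M.det = 0 → ∃ w v : Fin 2 → ℚ, w ≠ 0 ∧ v ≠ 0 ∧ ∑ i, ∑ j, (w i : ℂ) * M i j * (v j : ℂ) = 0) ↔ (∀ x y : Fin 2 → ℂ, LinearIndependent ℚ x → LinearIndependent ℚ y → ∃ i j, Transcendental ℚ (Complex.exp (x i * y j)))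

/-- item stmt-Schanuel-15353 · support · rank 9 · open · by planner
sources: DasguptaKakde2024, Masser1981
[support] the easy converse (o) ⟹ (m′) (DasguptaKakde2024 Prop 5.6 for the box X(2N)): an isotropic
pair ⟨a, b⟩_X = 1 makes v ↦ ⟨v, b⟩_X periodic modulo ℤa, so it takes ≤ C_a N^{n−1} values u_k on
[0,2N)ⁿ, and P = ∏ₖ (t^{b⁺} − u_k t^{b⁻}) (b = b⁺ − b⁻) is nonzero, supported on a segment (≤ C_a
N^{n−1} + 1 monomials < Nⁿ for large N) and vanishes on X(2N). Calibrates SparseVanishing and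
SupportMasser as mutual converses. ~300 lines. [difficulty: provable-now] -/
@[route_item "route-Schanuel-MatrixCoefficients"]
def SparseOfIsotropic : Prop :=
  ∀ (n : ℕ) (x : Fin n → Fin n → ℂ), (∀ i j, x i j ≠ 0) → (∃ a b : Fin n → ℤ, a ≠ 0 ∧ b ≠ 0 ∧ ∏ i, ∏ j, x i j ^ (a i * b j) = 1) → ∃ N₀ : ℕ, ∀ N : ℕ, N₀ ≤ N → ∃ P : MvPolynomial (Fin n) ℂ, P ≠ 0 ∧ P.support.card < N ^ n ∧ ∀ v : Fin n → ℕ, (∀ i, v i < 2 * N) → MvPolynomial.eval (fun j => ∏ i, x i j ^ (v i)) P = 0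

/-- item stmt-Schanuel-15354 · support · rank 9 · open · by planner
sources: DasguptaKakde2024
[support] what the authors' chain reaches over ℂ (planner's correction: the box-image X sees x_ij =
e^{L_ij} only, so (w) ⟹ (m′) ⟹ (o) yields the MULTIPLICATIVE matrix coefficient aᵗLb ∈ 2πiℤ, which
is wᵗLv = 0 exactly when L is real or 2πi-free — DK Thm 7.1 is stated over ℝ and ℂ_p for this
reason): SparseVanishing and SupportMasser give, for every singular L over 𝓛, nonzero integer a, b
and k ∈ ℤ with Σ aᵢbⱼL_ij = 2πik. Composition + Complex.exp_eq_one_iff, ~80 lines. [difficulty: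
provable-now] -/
@[route_item "route-Schanuel-MatrixCoefficients"]
def ChainToMultiplicative : Prop :=
  SparseVanishing → SupportMasser → ∀ (n : ℕ) (L : Matrix (Fin n) (Fin n) ℂ), (∀ i j, IsAlgebraic ℚ (Complex.exp (L i j))) → L.det = 0 → ∃ a b : Fin n → ℤ, a ≠ 0 ∧ b ≠ 0 ∧ ∃ k : ℤ, ∑ i, ∑ j, (a i : ℂ) * L i j * (b j : ℂ) = 2 * Real.pi * Complex.I * k

/-- item stmt-Schanuel-4317 · assembly · rank 1 · open · by planner
sources: Kirby2010EAEF, Waldschmidt2000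
[assembly] LogSector → OffLogSector → Schanuel. -/
@[route_item "route-Schanuel-MatrixCoefficients"]
def Assembly : Prop :=
  LogSector → OffLogSector → Schanuel

/-! D-0027 §2.1 — DECIDING THEOREM (planner-authored via `route open/edit --closes-file`; by planner-rbadge-Schanuel-MatrixCoefficients-1431da20-0 2026-08-16T15:25:18Z):
its hypotheses are this route's items and its conclusion the sub-problem Statement (glue_lint), and it elaborates with this file. -/

@[closes "route-Schanuel-MatrixCoefficients"] theorem closes (hLog : LogSector) (hOff : OffLogSector)
    (_hThree : MatrixCoefficientThree) (_hSupportMasser : SupportMasser)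
    (_hSparse : SparseVanishing) (_hMC : MatrixCoefficient) : _root_.Schanuel := by
  /- D-0027 §2.1 deciding theorem, PROVED glue (no `Assembly` hypothesis): Schanuel from the exact
     sector split LogSector ∧ OffLogSector at 𝓛 = exp⁻¹(ℚ̄).  Given z ∈ ℂⁿ ℚ-linearly independent,
     split V = span_ℚ z as (V ∩ span_ℚ 𝓛) ⊕ T' (bases l, x; k + m = n); span_ℚ 𝓛 = 𝓛, so LogSector
     makes l algebraically independent over ℚ inside K₀ = ℚ(𝓛); after clearing denominators
     (x' = N·x with e^{x'} ∈ ℚ(z, e^z)) OffLogSector gives trdeg_{K₀} K₀(x', e^{x'}) ≥ m, hence m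
     of the generators x', e^{x'} algebraically independent over K₀ (transcendence basis inside the
     generating set of Algebra.adjoin, whose fraction field is the IntermediateField.adjoin); the
     tower lemma `AlgebraicIndependent.sumElim_of_tower` joins them with l to k + m = n elements of
     ℚ(z, e^z) algebraically independent over ℚ.  The four rungs are items of the ladder inside
     LogSector, carried as hypotheses but not logical inputs. -/
  intro n z hz
  classical
  -- ℚ-scalar multiplication on ℂ is multiplication by the cast
  have qsm : ∀ (q : ℚ) (w : ℂ), q • w = (q : ℂ) * w := fun q w => Rat.smul_def q w
  -- notation
  set L : Set ℂ := {w : ℂ | IsAlgebraic ℚ (Complex.exp w)} with hL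
  set K₀ : IntermediateField ℚ ℂ := IntermediateField.adjoin ℚ L with hK₀
  set E : IntermediateField ℚ ℂ :=
    IntermediateField.adjoin ℚ (Set.range z ∪ Set.range (Complex.exp ∘ z)) with hE
  set S : Submodule ℚ ℂ := Submodule.span ℚ L with hS
  ------------------------------------------------------------------
  -- (1) the ℚ-span of 𝓛 is 𝓛: e^{Σ qᵢ wᵢ} is algebraic when the e^{wᵢ} are
  ------------------------------------------------------------------
  have hSL : ∀ w ∈ S, IsAlgebraic ℚ (Complex.exp w) := by
    intro w hw
    induction hw using Submodule.span_induction with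
    | mem w hw => exact hw
    | zero => rw [Complex.exp_zero]; exact isAlgebraic_one
    | add u v _ _ hu hv => rw [Complex.exp_add]; exact hu.mul hv
    | smul q w _ hw =>
      refine IsAlgebraic.of_pow q.den_pos ?_
      have hcast : ((q.den : ℂ)) * (q : ℂ) = (q.num : ℂ) := by
        have h := congrArg (fun r : ℚ => (r : ℂ)) (Rat.den_mul_eq_num q)
        push_cast at h
        exact h
      have key : Complex.exp (q • w) ^ q.den = Complex.exp ((q.num : ℂ) * w) := by
        rw [← Complex.exp_nat_mul, qsm, ← mul_assoc, hcast]
      rw [key, Complex.exp_int_mul]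
      obtain ⟨N, hN | hN⟩ := q.num.eq_nat_or_neg
      · rw [hN, zpow_natCast]; exact hw.pow N
      · rw [hN, zpow_neg, zpow_natCast]; exact (hw.pow N).inv
  ------------------------------------------------------------------
  -- (2) linear algebra: split span_ℚ(z) = (span_ℚ(z) ∩ S) ⊕ T'
  ------------------------------------------------------------------
  set V : Submodule ℚ ℂ := Submodule.span ℚ (Set.range z) with hV
  haveI : FiniteDimensional ℚ V := FiniteDimensional.span_of_finite ℚ (Set.finite_range z)
  set T : Submodule ℚ V := S.comap V.subtype with hT
  obtain ⟨T', hTT'⟩ := T.exists_isCompl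
  set k : ℕ := Module.finrank ℚ T with hk
  set m : ℕ := Module.finrank ℚ T' with hm
  have hVn : Module.finrank ℚ V = n := by
    simp only [V, finrank_span_eq_card hz, Fintype.card_fin]
  have hkm : k + m = n := by
    have h1 := Submodule.finrank_sup_add_finrank_inf_eq T T'
    rw [hTT'.sup_eq_top, hTT'.inf_eq_bot, finrank_top, finrank_bot, add_zero] at h1
    omega
  let bT := Module.finBasis ℚ T
  let bT' := Module.finBasis ℚ T'
  set l : Fin k → ℂ := fun i => (((bT i : T) : V) : ℂ) with hl
  set x : Fin m → ℂ := fun j => (((bT' j : T') : V) : ℂ) with hx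
  have hlS : ∀ i, l i ∈ S := fun i => (bT i).2
  have hlV : ∀ i, l i ∈ V := fun i => ((bT i : T) : V).2
  have hxV : ∀ j, x j ∈ V := fun j => ((bT' j : T') : V).2
  have hl_li : LinearIndependent ℚ l := by
    have h := (bT.linearIndependent.map' T.subtype T.ker_subtype).map' V.subtype V.ker_subtype
    exact h
  have hx_li : LinearIndependent ℚ (S.mkQ ∘ x) := by
    have h := bT'.linearIndependent.map' (S.mkQ ∘ₗ V.subtype ∘ₗ T'.subtype) ?_
    · exact h
    rw [Submodule.eq_bot_iff]
    intro t ht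
    rw [LinearMap.mem_ker] at ht
    simp only [LinearMap.coe_comp, Function.comp_apply, Submodule.coe_subtype, Submodule.mkQ_apply,
      Submodule.Quotient.mk_eq_zero] at ht
    have h1 : (t : V) ∈ T := ht
    have h2 : (t : V) ∈ T ⊓ T' := ⟨h1, t.2⟩
    rw [hTT'.inf_eq_bot, Submodule.mem_bot] at h2
    exact_mod_cast h2
  ------------------------------------------------------------------
  -- (3) membership in E = ℚ(z, e^z); integer rescaling of the off-sector part
  ------------------------------------------------------------------
  have hzE : ∀ i, z i ∈ E := fun i =>
    IntermediateField.subset_adjoin ℚ _ (Set.mem_union_left _ (Set.mem_range_self i))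
  have hezE : ∀ i, Complex.exp (z i) ∈ E := fun i =>
    IntermediateField.subset_adjoin ℚ _ (Set.mem_union_right _ ⟨i, rfl⟩)
  have hVE : ∀ v ∈ V, v ∈ E := by
    intro v hv
    induction hv using Submodule.span_induction with
    | mem w hw => obtain ⟨i, rfl⟩ := hw; exact hzE i
    | zero => exact zero_mem E
    | add u v _ _ hu hv => exact add_mem hu hv
    | smul q w _ hw => exact IntermediateField.smul_mem E hw
  have hscale : ∀ v ∈ V, ∃ N : ℕ, 0 < N ∧ Complex.exp ((N : ℂ) * v) ∈ E := by
    intro v hv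
    obtain ⟨c, hc⟩ := (Submodule.mem_span_range_iff_exists_fun ℚ).mp hv
    have hint : ∀ i, ∃ a : ℤ, ((∏ i', (c i').den : ℕ) : ℚ) * c i = a := by
      intro i
      obtain ⟨M, hM⟩ := Finset.dvd_prod_of_mem (fun i' => (c i').den) (Finset.mem_univ i)
      refine ⟨M * (c i).num, ?_⟩
      rw [hM]
      push_cast
      rw [mul_comm ((c i).den : ℚ) (M : ℚ), mul_assoc, Rat.den_mul_eq_num]
    choose a ha using hint
    refine ⟨∏ i', (c i').den, Finset.prod_pos (fun i _ => (c i).den_pos), ?_⟩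
    have key : ((∏ i', (c i').den : ℕ) : ℂ) * v = ∑ i, (a i : ℂ) * z i := by
      rw [← hc, Finset.mul_sum]
      refine Finset.sum_congr rfl fun i _ => ?_
      rw [qsm, ← mul_assoc]
      congr 1
      have h := congrArg (fun r : ℚ => (r : ℂ)) (ha i)
      push_cast at h ⊢
      exact h
    rw [key, Complex.exp_sum]
    refine prod_mem fun i _ => ?_
    rw [Complex.exp_int_mul]
    exact zpow_mem (hezE i) (a i)
  choose N hNpos hNexp using fun j => hscale (x j) (hxV j)
  set x' : Fin m → ℂ := fun j => (N j : ℂ) * x j with hx'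
  have hx'E : ∀ j, x' j ∈ E := fun j => mul_mem (natCast_mem E (N j)) (hVE _ (hxV j))
  have hex'E : ∀ j, Complex.exp (x' j) ∈ E := hNexp
  have hx'_li : LinearIndependent ℚ (S.mkQ ∘ x') := by
    have h := hx_li.units_smul fun j => Units.mk0 (N j : ℚ) (by exact_mod_cast (hNpos j).ne')
    convert h using 1
    funext j
    simp only [Function.comp_apply, Pi.smul_apply', Units.smul_mk0, x']
    rw [← map_smul, qsm]
    push_cast
    rfl
  ------------------------------------------------------------------
  -- (4) the two sector cruxes
  ------------------------------------------------------------------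
  have hl_alg : ∀ i, IsAlgebraic ℚ (Complex.exp (l i)) := fun i => hSL _ (hlS i)
  have hl_ai : AlgebraicIndependent ℚ l := hLog k l hl_alg hl_li
  have hoff := hOff m x' hx'_li
  ------------------------------------------------------------------
  -- (5) trdeg_{K₀} K₀(x', e^{x'}) ≥ m gives m generators algebraically independent over K₀
  ------------------------------------------------------------------
  set G : Set ℂ := Set.range x' ∪ Set.range (Complex.exp ∘ x') with hG
  set A₀ : Subalgebra K₀ ℂ := Algebra.adjoin K₀ G with hA₀
  haveI : FaithfulSMul K₀ A₀ :=
    (faithfulSMul_iff_algebraMap_injective K₀ A₀).mpr (algebraMap K₀ A₀).injective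
  set F' : IntermediateField K₀ ℂ := IntermediateField.adjoin K₀ G with hF'
  have hA₀F : Algebra.trdeg K₀ A₀ = Algebra.trdeg K₀ F' := by
    -- F' is the fraction field of A₀ (the scoped instances of
    -- `IntermediateField.algebraAdjoinAdjoin`, rebuilt locally), hence algebraic over it
    have hle : A₀ ≤ F'.toSubalgebra := IntermediateField.algebra_adjoin_le_adjoin K₀ G
    letI : Algebra A₀ F' := (Subalgebra.inclusion hle).toAlgebra
    haveI : IsScalarTower K₀ A₀ F' := Subalgebra.inclusion.isScalarTower_left hle _
    haveI : FaithfulSMul A₀ F' := Subalgebra.inclusion.faithfulSMul hle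
    haveI : IsFractionRing A₀ F' := .of_field _ _ fun ⟨_, h⟩ =>
      have ⟨r, hr, s, hs, eq⟩ := IntermediateField.mem_adjoin_iff_div.mp h
      ⟨⟨r, hr⟩, ⟨s, hs⟩, Subtype.ext eq⟩
    haveI : Algebra.IsAlgebraic A₀ F' := IsLocalization.isAlgebraic _ (nonZeroDivisors A₀)
    have h := trdeg_add_eq K₀ A₀ (A := F')
    have h0 : Algebra.trdeg A₀ F' = 0 := trdeg_eq_zero
    rw [h0, add_zero] at h
    exact h
  have hmA₀ : (m : Cardinal) ≤ Algebra.trdeg K₀ A₀ := by rw [hA₀F]; exact hoff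
  let g : Fin m ⊕ Fin m → ℂ := Sum.elim x' (Complex.exp ∘ x')
  have hg_mem : ∀ i, g i ∈ G := by
    rintro (j | j)
    · exact Set.mem_union_left _ ⟨j, rfl⟩
    · exact Set.mem_union_right _ ⟨j, rfl⟩
  have hG_eq : Set.range g = G := Set.Sum.elim_range _ _
  let g' : Fin m ⊕ Fin m → A₀ := fun i => ⟨g i, Algebra.subset_adjoin (hg_mem i)⟩
  have hadj : Algebra.adjoin K₀ (Set.range g') = ⊤ := by
    apply Subalgebra.map_injective (f := A₀.val) Subtype.val_injective
    rw [Algebra.map_top, Subalgebra.range_val, ← Algebra.adjoin_image, ← Set.range_comp]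
    have : (A₀.val : A₀ → ℂ) ∘ g' = g := funext fun i => rfl
    rw [this, hG_eq]
  haveI : Algebra.IsAlgebraic (Algebra.adjoin K₀ (Set.range g')) A₀ := by
    rw [hadj]
    exact ⟨fun a => isAlgebraic_algebraMap (⟨a, Algebra.mem_top⟩ : (⊤ : Subalgebra K₀ A₀))⟩
  obtain ⟨t, htg, ht⟩ := exists_isTranscendenceBasis_subset (R := K₀) (A := A₀) (Set.range g')
  have hcard : (m : Cardinal) ≤ Cardinal.mk t := by
    rw [ht.cardinalMk_eq_trdeg]; exact hmA₀
  obtain ⟨emb⟩ : Nonempty (Fin m ↪ t) := by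
    rw [← Cardinal.le_def, Cardinal.mk_fin]; exact hcard
  let y : Fin m → ℂ := fun j => (((emb j : t) : A₀) : ℂ)
  have hy_ai : AlgebraicIndependent K₀ y :=
    (ht.1.comp emb emb.injective).map' (f := A₀.val) Subtype.val_injective
  have hyG : ∀ j, y j ∈ G := by
    intro j
    obtain ⟨i, hi⟩ := htg (emb j).2
    have : g i = y j := congrArg Subtype.val hi
    rw [← this]; exact hg_mem i
  ------------------------------------------------------------------
  -- (6) glue the two towers: l over ℚ inside K₀, y over K₀; both inside E
  ------------------------------------------------------------------
  have hlK₀ : Set.range l ⊆ Set.range (algebraMap K₀ ℂ) := by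
    rintro _ ⟨i, rfl⟩
    have : l i ∈ K₀ := IntermediateField.subset_adjoin ℚ L (hl_alg i)
    exact ⟨⟨l i, this⟩, rfl⟩
  have hw_ai : AlgebraicIndependent ℚ (Sum.elim y l) := hl_ai.sumElim_of_tower hlK₀ hy_ai
  have hGE : G ⊆ E := by
    rintro w (⟨j, rfl⟩ | ⟨j, rfl⟩)
    · exact hx'E j
    · exact hex'E j
  have hw_mem : ∀ i, Sum.elim y l i ∈ E := by
    rintro (j | i)
    · exact hGE (hyG j)
    · exact hVE _ (hlV i)
  let w' : Fin m ⊕ Fin k → E := fun i => ⟨Sum.elim y l i, hw_mem i⟩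
  have hw'_ai : AlgebraicIndependent ℚ w' :=
    AlgebraicIndependent.of_comp E.val (by exact hw_ai)
  have hfinal := hw'_ai.cardinalMk_le_trdeg
  simp only [Cardinal.mk_sum, Cardinal.mk_fin, Cardinal.lift_natCast] at hfinal
  have hn : (n : Cardinal) = (m : Cardinal) + (k : Cardinal) := by
    rw [← hkm, Nat.cast_add, add_comm]
  rw [hn]
  exact hfinal

end Summit.Schanuel.Schanuel.Theses.MatrixCoefficients
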